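import Literature.Topology.FourManifolds.CappellShanesonClassGroupThirtytwo
import Literature.Topology.FourManifolds.CappellShanesonClassGroupThirtytwoCls
import Literature.Topology.FourManifolds.CappellShanesonTotallyReal
import Literature.Topology.FourManifolds.CappellShanesonClassGroupTwelve
import Literature.Topology.FourManifolds.CappellShanesonClassGroupFifteen
import HarnessLib

/-!
# Trace `32`: the class group, the cover of `C(ℤ[Θ₃₂])`, Gompf's conjecture for the traces `32` and `-27`

Part 'Main' of the certified class-group computation for the trace `32` field behind
Kim–Yamada's Theorem B (`GompfConjectureForTrace 32` and, by Theorem A, `-27`), serving the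
named fact
`Literature.Topology.FourManifolds.kimYamada2023_nonempty_diffeomorph_sphere_four_of_trace_mem_Icc`
(`CappellShaneson.lean`; M. H. Kim, S. Yamada, Kyungpook Math. J. 63 (2023) 373–411 =
arXiv:1707.03860, Cor. C). The computation is split over several files only because of the
proposal size limit: `…ClassGroupThirtytwo.lean` (discriminant, `𝓞 K = ℤ[θ]`, the primes of small norm), `…ClassGroupThirtytwoRel<k>.lean` (two-ideal relations with certified generators and the non-vanishing of the generators), `…ClassGroupThirtytwoCls.lean` (the class of every small prime in terms of the generator(s), the order relations), `…ClassGroupThirtytwoMain.lean` (generation of the class group by Minkowski's bound, the cover of `C(ℤ[Θ])` by standard-matrix representatives, Gompf's conjecture for the two traces). (File generated from a certified computation; every relation is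
checked by the Lean kernel; no named fact is introduced, D-0026.)

## References

* [KimYamada2023] M. H. Kim, S. Yamada, Kyungpook Math. J. 63 (2023) 373–411 (arXiv:1707.03860):
  §2.3 (Prop. 2.14), §6.1 (Lemma 6.1 and the proof of Thm. B), Thm. A.
* [Marcus2018] D. A. Marcus, *Number Fields*, 2nd ed., Ch. 3, Thm. 27 (Dedekind–Kummer); Ch. 5,
  Cor. 2 of Thm. 37 (Minkowski bound) and the class-group computations after it.
-/

noncomputable section

open Set Polynomial Module NumberField Ideal
open scoped NumberField MatrixGroups nonZeroDivisors
open Literature.LinearAlgebra.Matrix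

namespace Literature.Topology.FourManifolds

section Field

variable {K : Type*} [Field K] [NumberField K] {θ : K}

set_option maxHeartbeats 2000000 in
/-- **Every ideal class of the trace `32` field is a power `aʳ`, `0 ≤ r < 6`, of `a = [(5, θ - 4)]`,
represented by the ideals listed** (so the class number divides `6`). Proof: `d_K = 751657`,
`⌊M_K⌋ ≤ 192`, Dedekind–Kummer at `p ≤ 192`, and the class of every small prime computed above
from two-ideal relations with certified generators. [cite: KimYamada2023, §6.1 (proof of Thm. B)] -/
theorem classGroup_mem_thirtytwo (hθ : aeval θ (csPoly 32) = 0) (h3 : finrank ℚ K = 3)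
    (C : ClassGroup (𝓞 K)) :
    C = 1 ∨
      C = ClassGroup.mk0 ⟨span {(5 : 𝓞 K), thetaInt hθ - 4}, (span_pair_ofNat_mem_nonZeroDivisors (nat_lit 5) (thetaInt hθ - 4))⟩ ∨
      C = ClassGroup.mk0 ⟨span {(23 : 𝓞 K), thetaInt hθ - 18}, (span_pair_ofNat_mem_nonZeroDivisors (nat_lit 23) (thetaInt hθ - 18))⟩ ∨
      C = ClassGroup.mk0 ⟨span {(13 : 𝓞 K), thetaInt hθ - 3}, (span_pair_ofNat_mem_nonZeroDivisors (nat_lit 13) (thetaInt hθ - 3))⟩ ∨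
      C = ClassGroup.mk0 ⟨span {(13 : 𝓞 K), thetaInt hθ - 4}, (span_pair_ofNat_mem_nonZeroDivisors (nat_lit 13) (thetaInt hθ - 4))⟩ ∨
      C = ClassGroup.mk0 ⟨span {(13 : 𝓞 K), thetaInt hθ - 12}, (span_pair_ofNat_mem_nonZeroDivisors (nat_lit 13) (thetaInt hθ - 12))⟩ := by
  classical
  obtain ⟨a, ha⟩ : ∃ a : ClassGroup (𝓞 K), ClassGroup.mk0 ⟨span {(5 : 𝓞 K), thetaInt hθ - 4}, (span_pair_ofNat_mem_nonZeroDivisors (nat_lit 5) (thetaInt hθ - 4))⟩ = a := ⟨_, rfl⟩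
  have ham : a ^ (6 : ℤ) = 1 := by rw [← ha]; exact pow_order_thirtytwo hθ
  let H : Subgroup (ClassGroup (𝓞 K)) := Subgroup.zpowers a
  have hprinc : ∀ (P : Ideal (𝓞 K)) (hP0 : P ∈ (Ideal (𝓞 K))⁰) (x : 𝓞 K), P = span {x} →
      ClassGroup.mk0 ⟨P, hP0⟩ ∈ H := by
    intro P hP0 x hPx
    have : ClassGroup.mk0 ⟨P, hP0⟩ = 1 :=
      (ClassGroup.mk0_eq_one_iff hP0).mpr ⟨⟨x, by rw [hPx, submodule_span_eq]⟩⟩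
    rw [this]
    exact H.one_mem
  -- Minkowski: `⌊M_K⌋ ≤ 192`
  have hd : ((|NumberField.discr K| : ℤ) : ℝ) ≤ (751657 : ℕ) := by
    rw [discr_eq_thirtytwo hθ h3]
    norm_num
  have hfloor := floor_minkowskiBound_le_cubic_real h3 (nrComplexPlaces_eq_zero_of_csPoly hθ h3 (by norm_num))
    hd (s := 867) (U := 192) (by norm_num) (by norm_num) (by norm_num)
  have htop : H = ⊤ := by
    refine classGroup_subgroup_eq_top_of_primesOver H hfloor fun p hp hprime P hP0 hP hle => ?_
    have hpU : p ≤ 192 := (Finset.mem_Icc.mp hp).2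
    have h1p : 1 ≤ p := (Finset.mem_Icc.mp hp).1
    interval_cases p
    · exact absurd hprime (by norm_num)
    · exact hprinc P hP0 _ (eq_span_of_inert_thirtytwo hθ h3 (by norm_num) hP)
    · exact hprinc P hP0 _ (eq_span_of_inert_thirtytwo hθ h3 (by norm_num) hP)
    · exact absurd hprime (by norm_num)
    · -- `p = 5`
      rcases eq_P5_or_eq_Q5_thirtytwo hθ h3 hP with h | h <;> subst h
      · rw [show ClassGroup.mk0 ⟨_, hP0⟩ = ClassGroup.mk0 ⟨span {(5 : 𝓞 K), thetaInt hθ - 4}, (span_pair_ofNat_mem_nonZeroDivisors (nat_lit 5) (thetaInt hθ - 4))⟩ from rfl, ha]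
        exact Subgroup.mem_zpowers a
      · exact mem_zpowers_of_mk0_eq a (cls_Q5_thirtytwo hθ) ha
    · exact absurd hprime (by norm_num)
    · exact hprinc P hP0 _ (eq_span_of_inert_thirtytwo hθ h3 (by norm_num) hP)
    · exact absurd hprime (by norm_num)
    · exact absurd hprime (by norm_num)
    · exact absurd hprime (by norm_num)
    · exact hprinc P hP0 _ (eq_span_of_inert_thirtytwo hθ h3 (by norm_num) hP)
    · exact absurd hprime (by norm_num)
    · -- `p = 13` (splits)
      rcases eq_P13_thirtytwo hθ h3 hP with h | h | h <;> subst h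
      · exact mem_zpowers_of_mk0_eq a (cls_P13_3_thirtytwo hθ) ha
      · exact mem_zpowers_of_mk0_eq a (cls_P13_4_thirtytwo hθ) ha
      · exact mem_zpowers_of_mk0_eq a (cls_P13_12_thirtytwo hθ) ha
    · exact absurd hprime (by norm_num)
    · exact absurd hprime (by norm_num)
    · exact absurd hprime (by norm_num)
    · exact hprinc P hP0 _ (eq_span_of_inert_thirtytwo hθ h3 (by norm_num) hP)
    · exact absurd hprime (by norm_num)
    · exact hprinc P hP0 _ (eq_span_of_inert_thirtytwo hθ h3 (by norm_num) hP)
    · exact absurd hprime (by norm_num)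
    · exact absurd hprime (by norm_num)
    · exact absurd hprime (by norm_num)
    · -- `p = 23`
      have h := eq_span_pair_of_unique_root_thirtytwo hθ h3 (Or.inl ⟨rfl, rfl⟩) hP hle
      simp only [Nat.cast_ofNat, Int.cast_ofNat] at h
      subst h
      exact mem_zpowers_of_mk0_eq a (cls_P23_18_thirtytwo hθ) ha
    · exact absurd hprime (by norm_num)
    · exact absurd hprime (by norm_num)
    · exact absurd hprime (by norm_num)
    · exact absurd hprime (by norm_num)
    · exact absurd hprime (by norm_num)
    · exact hprinc P hP0 _ (eq_span_of_inert_thirtytwo hθ h3 (by norm_num) hP)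
    · exact absurd hprime (by norm_num)
    · -- `p = 31` (ramified)
      rcases eq_P31_thirtytwo hθ h3 hP with h | h | h <;> subst h
      · exact mem_zpowers_of_mk0_eq a (cls_P31_10_thirtytwo hθ) ha
      · exact mem_zpowers_of_mk0_eq a (cls_P31_11_thirtytwo hθ) ha
      · exact mem_zpowers_of_mk0_eq a (cls_P31_11_thirtytwo hθ) ha
    · exact absurd hprime (by norm_num)
    · exact absurd hprime (by norm_num)
    · exact absurd hprime (by norm_num)
    · exact absurd hprime (by norm_num)
    · exact absurd hprime (by norm_num)
    · -- `p = 37`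
      have h := eq_span_pair_of_unique_root_thirtytwo hθ h3 (Or.inr (Or.inl ⟨rfl, rfl⟩)) hP hle
      simp only [Nat.cast_ofNat, Int.cast_ofNat] at h
      subst h
      exact mem_zpowers_of_mk0_eq a (cls_P37_20_thirtytwo hθ) ha
    · exact absurd hprime (by norm_num)
    · exact absurd hprime (by norm_num)
    · exact absurd hprime (by norm_num)
    · exact hprinc P hP0 _ (eq_span_of_inert_thirtytwo hθ h3 (by norm_num) hP)
    · exact absurd hprime (by norm_num)
    · exact hprinc P hP0 _ (eq_span_of_inert_thirtytwo hθ h3 (by norm_num) hP)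
    · exact absurd hprime (by norm_num)
    · exact absurd hprime (by norm_num)
    · exact absurd hprime (by norm_num)
    · -- `p = 47`
      have h := eq_span_pair_of_unique_root_thirtytwo hθ h3 (Or.inr (Or.inr (Or.inl ⟨rfl, rfl⟩))) hP hle
      simp only [Nat.cast_ofNat, Int.cast_ofNat] at h
      subst h
      exact mem_zpowers_of_mk0_eq a (cls_P47_42_thirtytwo hθ) ha
    · exact absurd hprime (by norm_num)
    · exact absurd hprime (by norm_num)
    · exact absurd hprime (by norm_num)
    · exact absurd hprime (by norm_num)
    · exact absurd hprime (by norm_num)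
    · -- `p = 53` (splits)
      rcases eq_P53_thirtytwo hθ h3 hP with h | h | h <;> subst h
      · exact mem_zpowers_of_mk0_eq a (cls_P53_13_thirtytwo hθ) ha
      · exact hprinc _ hP0 _ (P53_27_eq_thirtytwo hθ)
      · exact mem_zpowers_of_mk0_eq a (cls_P53_45_thirtytwo hθ) ha
    · exact absurd hprime (by norm_num)
    · exact absurd hprime (by norm_num)
    · exact absurd hprime (by norm_num)
    · exact absurd hprime (by norm_num)
    · exact absurd hprime (by norm_num)
    · -- `p = 59`
      have h := eq_span_pair_of_unique_root_thirtytwo hθ h3 (Or.inr (Or.inr (Or.inr (Or.inl ⟨rfl, rfl⟩)))) hP hle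
      simp only [Nat.cast_ofNat, Int.cast_ofNat] at h
      subst h
      exact hprinc _ hP0 _ (P59_2_eq_thirtytwo hθ)
    · exact absurd hprime (by norm_num)
    · -- `p = 61` (splits)
      rcases eq_P61_thirtytwo hθ h3 hP with h | h | h <;> subst h
      · exact mem_zpowers_of_mk0_eq a (cls_P61_10_thirtytwo hθ) ha
      · exact mem_zpowers_of_mk0_eq a (cls_P61_37_thirtytwo hθ) ha
      · exact mem_zpowers_of_mk0_eq a (cls_P61_46_thirtytwo hθ) ha
    · exact absurd hprime (by norm_num)
    · exact absurd hprime (by norm_num)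
    · exact absurd hprime (by norm_num)
    · exact absurd hprime (by norm_num)
    · exact absurd hprime (by norm_num)
    · -- `p = 67`
      have h := eq_span_pair_of_unique_root_thirtytwo hθ h3 (Or.inr (Or.inr (Or.inr (Or.inr (Or.inl ⟨rfl, rfl⟩))))) hP hle
      simp only [Nat.cast_ofNat, Int.cast_ofNat] at h
      subst h
      exact mem_zpowers_of_mk0_eq a (cls_P67_30_thirtytwo hθ) ha
    · exact absurd hprime (by norm_num)
    · exact absurd hprime (by norm_num)
    · exact absurd hprime (by norm_num)
    · -- `p = 71`
      have h := eq_span_pair_of_unique_root_thirtytwo hθ h3 (Or.inr (Or.inr (Or.inr (Or.inr (Or.inr (Or.inl ⟨rfl, rfl⟩)))))) hP hle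
      simp only [Nat.cast_ofNat, Int.cast_ofNat] at h
      subst h
      exact mem_zpowers_of_mk0_eq a (cls_P71_11_thirtytwo hθ) ha
    · exact absurd hprime (by norm_num)
    · exact hprinc P hP0 _ (eq_span_of_inert_thirtytwo hθ h3 (by norm_num) hP)
    · exact absurd hprime (by norm_num)
    · exact absurd hprime (by norm_num)
    · exact absurd hprime (by norm_num)
    · exact absurd hprime (by norm_num)
    · exact absurd hprime (by norm_num)
    · exact hprinc P hP0 _ (eq_span_of_inert_thirtytwo hθ h3 (by norm_num) hP)
    · exact absurd hprime (by norm_num)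
    · exact absurd hprime (by norm_num)
    · exact absurd hprime (by norm_num)
    · exact hprinc P hP0 _ (eq_span_of_inert_thirtytwo hθ h3 (by norm_num) hP)
    · exact absurd hprime (by norm_num)
    · exact absurd hprime (by norm_num)
    · exact absurd hprime (by norm_num)
    · exact absurd hprime (by norm_num)
    · exact absurd hprime (by norm_num)
    · -- `p = 89`
      have h := eq_span_pair_of_unique_root_thirtytwo hθ h3 (Or.inr (Or.inr (Or.inr (Or.inr (Or.inr (Or.inr (Or.inl ⟨rfl, rfl⟩))))))) hP hle
      simp only [Nat.cast_ofNat, Int.cast_ofNat] at h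
      subst h
      exact mem_zpowers_of_mk0_eq a (cls_P89_64_thirtytwo hθ) ha
    · exact absurd hprime (by norm_num)
    · exact absurd hprime (by norm_num)
    · exact absurd hprime (by norm_num)
    · exact absurd hprime (by norm_num)
    · exact absurd hprime (by norm_num)
    · exact absurd hprime (by norm_num)
    · exact absurd hprime (by norm_num)
    · exact hprinc P hP0 _ (eq_span_of_inert_thirtytwo hθ h3 (by norm_num) hP)
    · exact absurd hprime (by norm_num)
    · exact absurd hprime (by norm_num)
    · exact absurd hprime (by norm_num)
    · -- `p = 101`
      have h := eq_span_pair_of_unique_root_thirtytwo hθ h3 (Or.inr (Or.inr (Or.inr (Or.inr (Or.inr (Or.inr (Or.inr (Or.inl ⟨rfl, rfl⟩)))))))) hP hle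
      simp only [Nat.cast_ofNat, Int.cast_ofNat] at h
      subst h
      exact mem_zpowers_of_mk0_eq a (cls_P101_40_thirtytwo hθ) ha
    · exact absurd hprime (by norm_num)
    · exact hprinc P hP0 _ (eq_span_of_inert_thirtytwo hθ h3 (by norm_num) hP)
    · exact absurd hprime (by norm_num)
    · exact absurd hprime (by norm_num)
    · exact absurd hprime (by norm_num)
    · exact hprinc P hP0 _ (eq_span_of_inert_thirtytwo hθ h3 (by norm_num) hP)
    · exact absurd hprime (by norm_num)
    · exact hprinc P hP0 _ (eq_span_of_inert_thirtytwo hθ h3 (by norm_num) hP)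
    · exact absurd hprime (by norm_num)
    · exact absurd hprime (by norm_num)
    · exact absurd hprime (by norm_num)
    · -- `p = 113`
      have h := eq_span_pair_of_unique_root_thirtytwo hθ h3 (Or.inr (Or.inr (Or.inr (Or.inr (Or.inr (Or.inr (Or.inr (Or.inr (Or.inl ⟨rfl, rfl⟩))))))))) hP hle
      simp only [Nat.cast_ofNat, Int.cast_ofNat] at h
      subst h
      exact mem_zpowers_of_mk0_eq a (cls_P113_20_thirtytwo hθ) ha
    · exact absurd hprime (by norm_num)
    · exact absurd hprime (by norm_num)
    · exact absurd hprime (by norm_num)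
    · exact absurd hprime (by norm_num)
    · exact absurd hprime (by norm_num)
    · exact absurd hprime (by norm_num)
    · exact absurd hprime (by norm_num)
    · exact absurd hprime (by norm_num)
    · exact absurd hprime (by norm_num)
    · exact absurd hprime (by norm_num)
    · exact absurd hprime (by norm_num)
    · exact absurd hprime (by norm_num)
    · exact absurd hprime (by norm_num)
    · exact hprinc P hP0 _ (eq_span_of_inert_thirtytwo hθ h3 (by norm_num) hP)
    · exact absurd hprime (by norm_num)
    · exact absurd hprime (by norm_num)
    · exact absurd hprime (by norm_num)
    · -- `p = 131`
      have h := eq_span_pair_of_unique_root_thirtytwo hθ h3 (Or.inr (Or.inr (Or.inr (Or.inr (Or.inr (Or.inr (Or.inr (Or.inr (Or.inr (Or.inl ⟨rfl, rfl⟩)))))))))) hP hle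
      simp only [Nat.cast_ofNat, Int.cast_ofNat] at h
      subst h
      exact mem_zpowers_of_mk0_eq a (cls_P131_37_thirtytwo hθ) ha
    · exact absurd hprime (by norm_num)
    · exact absurd hprime (by norm_num)
    · exact absurd hprime (by norm_num)
    · exact absurd hprime (by norm_num)
    · exact absurd hprime (by norm_num)
    · -- `p = 137`
      have h := eq_span_pair_of_unique_root_thirtytwo hθ h3 (Or.inr (Or.inr (Or.inr (Or.inr (Or.inr (Or.inr (Or.inr (Or.inr (Or.inr (Or.inr (Or.inl ⟨rfl, rfl⟩))))))))))) hP hle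
      simp only [Nat.cast_ofNat, Int.cast_ofNat] at h
      subst h
      exact mem_zpowers_of_mk0_eq a (cls_P137_96_thirtytwo hθ) ha
    · exact absurd hprime (by norm_num)
    · -- `p = 139`
      have h := eq_span_pair_of_unique_root_thirtytwo hθ h3 (Or.inr (Or.inr (Or.inr (Or.inr (Or.inr (Or.inr (Or.inr (Or.inr (Or.inr (Or.inr (Or.inr (Or.inl ⟨rfl, rfl⟩)))))))))))) hP hle
      simp only [Nat.cast_ofNat, Int.cast_ofNat] at h
      subst h
      exact mem_zpowers_of_mk0_eq a (cls_P139_40_thirtytwo hθ) ha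
    · exact absurd hprime (by norm_num)
    · exact absurd hprime (by norm_num)
    · exact absurd hprime (by norm_num)
    · exact absurd hprime (by norm_num)
    · exact absurd hprime (by norm_num)
    · exact absurd hprime (by norm_num)
    · exact absurd hprime (by norm_num)
    · exact absurd hprime (by norm_num)
    · exact absurd hprime (by norm_num)
    · -- `p = 149`
      have h := eq_span_pair_of_unique_root_thirtytwo hθ h3 (Or.inr (Or.inr (Or.inr (Or.inr (Or.inr (Or.inr (Or.inr (Or.inr (Or.inr (Or.inr (Or.inr (Or.inr (Or.inl ⟨rfl, rfl⟩))))))))))))) hP hle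
      simp only [Nat.cast_ofNat, Int.cast_ofNat] at h
      subst h
      exact mem_zpowers_of_mk0_eq a (cls_P149_102_thirtytwo hθ) ha
    · exact absurd hprime (by norm_num)
    · -- `p = 151`
      have h := eq_span_pair_of_unique_root_thirtytwo hθ h3 (Or.inr (Or.inr (Or.inr (Or.inr (Or.inr (Or.inr (Or.inr (Or.inr (Or.inr (Or.inr (Or.inr (Or.inr (Or.inr (Or.inl ⟨rfl, rfl⟩)))))))))))))) hP hle
      simp only [Nat.cast_ofNat, Int.cast_ofNat] at h
      subst h
      exact mem_zpowers_of_mk0_eq a (cls_P151_125_thirtytwo hθ) ha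
    · exact absurd hprime (by norm_num)
    · exact absurd hprime (by norm_num)
    · exact absurd hprime (by norm_num)
    · exact absurd hprime (by norm_num)
    · exact absurd hprime (by norm_num)
    · -- `p = 157`
      have h := eq_span_pair_of_unique_root_thirtytwo hθ h3 (Or.inr (Or.inr (Or.inr (Or.inr (Or.inr (Or.inr (Or.inr (Or.inr (Or.inr (Or.inr (Or.inr (Or.inr (Or.inr (Or.inr (Or.inl ⟨rfl, rfl⟩))))))))))))))) hP hle
      simp only [Nat.cast_ofNat, Int.cast_ofNat] at h
      subst h
      exact hprinc _ hP0 _ (P157_105_eq_thirtytwo hθ)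
    · exact absurd hprime (by norm_num)
    · exact absurd hprime (by norm_num)
    · exact absurd hprime (by norm_num)
    · exact absurd hprime (by norm_num)
    · exact absurd hprime (by norm_num)
    · exact hprinc P hP0 _ (eq_span_of_inert_thirtytwo hθ h3 (by norm_num) hP)
    · exact absurd hprime (by norm_num)
    · exact absurd hprime (by norm_num)
    · exact absurd hprime (by norm_num)
    · exact hprinc P hP0 _ (eq_span_of_inert_thirtytwo hθ h3 (by norm_num) hP)
    · exact absurd hprime (by norm_num)
    · exact absurd hprime (by norm_num)
    · exact absurd hprime (by norm_num)
    · exact absurd hprime (by norm_num)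
    · exact absurd hprime (by norm_num)
    · -- `p = 173`
      have h := eq_span_pair_of_unique_root_thirtytwo hθ h3 (Or.inr (Or.inr (Or.inr (Or.inr (Or.inr (Or.inr (Or.inr (Or.inr (Or.inr (Or.inr (Or.inr (Or.inr (Or.inr (Or.inr (Or.inr (⟨rfl, rfl⟩)))))))))))))))) hP hle
      simp only [Nat.cast_ofNat, Int.cast_ofNat] at h
      subst h
      exact mem_zpowers_of_mk0_eq a (cls_P173_18_thirtytwo hθ) ha
    · exact absurd hprime (by norm_num)
    · exact absurd hprime (by norm_num)
    · exact absurd hprime (by norm_num)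
    · exact absurd hprime (by norm_num)
    · exact absurd hprime (by norm_num)
    · exact hprinc P hP0 _ (eq_span_of_inert_thirtytwo hθ h3 (by norm_num) hP)
    · exact absurd hprime (by norm_num)
    · -- `p = 181` (splits)
      rcases eq_P181_thirtytwo hθ h3 hP with h | h | h <;> subst h
      · exact mem_zpowers_of_mk0_eq a (cls_P181_88_thirtytwo hθ) ha
      · exact mem_zpowers_of_mk0_eq a (cls_P181_140_thirtytwo hθ) ha
      · exact mem_zpowers_of_mk0_eq a (cls_P181_166_thirtytwo hθ) ha
    · exact absurd hprime (by norm_num)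
    · exact absurd hprime (by norm_num)
    · exact absurd hprime (by norm_num)
    · exact absurd hprime (by norm_num)
    · exact absurd hprime (by norm_num)
    · exact absurd hprime (by norm_num)
    · exact absurd hprime (by norm_num)
    · exact absurd hprime (by norm_num)
    · exact absurd hprime (by norm_num)
    · exact hprinc P hP0 _ (eq_span_of_inert_thirtytwo hθ h3 (by norm_num) hP)
    · exact absurd hprime (by norm_num)
  have hC : C ∈ H := by rw [htop]; exact Subgroup.mem_top C
  obtain ⟨k, rfl⟩ := Subgroup.mem_zpowers_iff.mp hC
  obtain ⟨q, r, hr, rfl⟩ : ∃ q r : ℤ, (r = 0 ∨ r = 1 ∨ r = 2 ∨ r = 3 ∨ r = 4 ∨ r = 5) ∧ k = 6 * q + r :=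
    ⟨k / 6, k % 6, by omega, by omega⟩
  rw [zpow_add, zpow_mul, ham, one_zpow, one_mul]
  rcases hr with rfl | rfl | rfl | rfl | rfl | rfl
  · exact Or.inl (zpow_zero a)
  · right; left
    rw [show (1 : ℤ) = 1 + 6 * (0) by norm_num, zpow_add, zpow_mul, ham, one_zpow, mul_one,
      zpow_one, ← ha]
  · right; right; left
    rw [show (2 : ℤ) = 2 + 6 * (0) by norm_num, zpow_add, zpow_mul, ham, one_zpow, mul_one,
      ← ha, ← cls_P23_18_thirtytwo hθ]
  · right; right; right; left
    rw [show (3 : ℤ) = -3 + 6 * (1) by norm_num, zpow_add, zpow_mul, ham, one_zpow, mul_one,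
      ← ha, ← cls_P13_3_thirtytwo hθ]
  · right; right; right; right; left
    rw [show (4 : ℤ) = -2 + 6 * (1) by norm_num, zpow_add, zpow_mul, ham, one_zpow, mul_one,
      ← ha, ← cls_P13_4_thirtytwo hθ]
  · right; right; right; right; right
    rw [show (5 : ℤ) = -1 + 6 * (1) by norm_num, zpow_add, zpow_mul, ham, one_zpow, mul_one,
      ← ha, ← cls_P13_12_thirtytwo hθ]


end Field


/-! ### The ideal classes of `ℤ[X]/(f₃₂)` and Gompf's conjecture for the traces `32` and `-27` -/

section Matrices

set_option maxHeartbeats 1000000 in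
/-- **The ideal classes of `ℤ[Θ₃₂] = ℤ[X]/(f₃₂)`**: every non-zero ideal is in the class of one of
`⟨Θ - 1, 1⟩`, `⟨Θ - 4, 5⟩`, `⟨Θ - 18, 23⟩`, `⟨Θ - 3, 13⟩`, `⟨Θ - 4, 13⟩`, `⟨Θ - 12, 13⟩` (these representatives cover `C(ℤ[Θ₃₂])`). [cite: KimYamada2023, §6.1 (proof of Thm. B)] -/
theorem ideal_class_adjoinRoot_thirtytwo (J : Ideal (AdjoinRoot (csPoly 32))) (hJ : J ≠ ⊥) :
    ∃ x y : AdjoinRoot (csPoly 32), x ≠ 0 ∧ y ≠ 0 ∧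
      (span {x} * J = span {y} * csIdeal 1 1 32 ∨ span {x} * J = span {y} * csIdeal 4 5 32 ∨ span {x} * J = span {y} * csIdeal 18 23 32 ∨ span {x} * J = span {y} * csIdeal 3 13 32 ∨ span {x} * J = span {y} * csIdeal 4 13 32 ∨ span {x} * J = span {y} * csIdeal 12 13 32) := by
  classical
  set θ' := AdjoinRoot.root (csPolyQ 32) with hθ'
  have hθ : aeval θ' (csPoly 32) = 0 := aeval_root_csPoly 32
  have h3 : finrank ℚ (CSField 32) = 3 := finrank_CSField 32
  obtain ⟨e, he⟩ := exists_ringEquiv_adjoinRoot_of_sq hθ h3 csDisc_thirtytwo_sq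
  set I : Ideal (𝓞 (CSField 32)) := J.map e with hI
  have hIJ : I.map (e.symm : 𝓞 (CSField 32) →+* AdjoinRoot (csPoly 32)) = J := by
    rw [hI]
    exact Ideal.map_of_equiv e (I := J)
  have hI0 : I ≠ ⊥ := by
    intro h0
    apply hJ
    rw [← hIJ, h0, Ideal.map_bot]
  have hImem : I ∈ (Ideal (𝓞 (CSField 32)))⁰ := mem_nonZeroDivisors_iff_ne_zero.mpr hI0
  have hsymm : ∀ x, (e.symm : 𝓞 (CSField 32) →+* AdjoinRoot (csPoly 32)) (e x) = x :=
    fun x => e.symm_apply_apply x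
  have hP5_4 : (span {(5 : 𝓞 (CSField 32)), thetaInt hθ - 4}).map
      (e.symm : 𝓞 (CSField 32) →+* AdjoinRoot (csPoly 32)) = csIdeal 4 5 32 := by
    rw [Ideal.map_span, Set.image_insert_eq, Set.image_singleton, map_sub, ← he, hsymm, map_ofNat,
      map_ofNat, csIdeal, Set.pair_comm]
    simp
  have hP23_18 : (span {(23 : 𝓞 (CSField 32)), thetaInt hθ - 18}).map
      (e.symm : 𝓞 (CSField 32) →+* AdjoinRoot (csPoly 32)) = csIdeal 18 23 32 := by
    rw [Ideal.map_span, Set.image_insert_eq, Set.image_singleton, map_sub, ← he, hsymm, map_ofNat,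
      map_ofNat, csIdeal, Set.pair_comm]
    simp
  have hP13_3 : (span {(13 : 𝓞 (CSField 32)), thetaInt hθ - 3}).map
      (e.symm : 𝓞 (CSField 32) →+* AdjoinRoot (csPoly 32)) = csIdeal 3 13 32 := by
    rw [Ideal.map_span, Set.image_insert_eq, Set.image_singleton, map_sub, ← he, hsymm, map_ofNat,
      map_ofNat, csIdeal, Set.pair_comm]
    simp
  have hP13_4 : (span {(13 : 𝓞 (CSField 32)), thetaInt hθ - 4}).map
      (e.symm : 𝓞 (CSField 32) →+* AdjoinRoot (csPoly 32)) = csIdeal 4 13 32 := by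
    rw [Ideal.map_span, Set.image_insert_eq, Set.image_singleton, map_sub, ← he, hsymm, map_ofNat,
      map_ofNat, csIdeal, Set.pair_comm]
    simp
  have hP13_12 : (span {(13 : 𝓞 (CSField 32)), thetaInt hθ - 12}).map
      (e.symm : 𝓞 (CSField 32) →+* AdjoinRoot (csPoly 32)) = csIdeal 12 13 32 := by
    rw [Ideal.map_span, Set.image_insert_eq, Set.image_singleton, map_sub, ← he, hsymm, map_ofNat,
      map_ofNat, csIdeal, Set.pair_comm]
    simp
  have hcase : ∀ (P : Ideal (𝓞 (CSField 32))) (hP0 : P ∈ (Ideal (𝓞 (CSField 32)))⁰)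
      (Q : Ideal (AdjoinRoot (csPoly 32))),
      P.map (e.symm : 𝓞 (CSField 32) →+* AdjoinRoot (csPoly 32)) = Q →
      ClassGroup.mk0 ⟨I, hImem⟩ = ClassGroup.mk0 ⟨P, hP0⟩ →
        ∃ x y : AdjoinRoot (csPoly 32), x ≠ 0 ∧ y ≠ 0 ∧ span {x} * J = span {y} * Q := by
    intro P hP0 Q hPQ hcls
    obtain ⟨x, y, hx, hy, hxy⟩ := ClassGroup.mk0_eq_mk0_iff.mp hcls
    refine ⟨(e.symm : 𝓞 (CSField 32) →+* AdjoinRoot (csPoly 32)) x,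
      (e.symm : 𝓞 (CSField 32) →+* AdjoinRoot (csPoly 32)) y,
      (map_ne_zero_iff _ e.symm.injective).mpr hx, (map_ne_zero_iff _ e.symm.injective).mpr hy, ?_⟩
    have h := congrArg (Ideal.map (e.symm : 𝓞 (CSField 32) →+* AdjoinRoot (csPoly 32))) hxy
    simp only [Ideal.map_mul, Ideal.map_span, Set.image_singleton] at h
    rw [hIJ, hPQ] at h
    exact h
  rcases classGroup_mem_thirtytwo hθ h3 (ClassGroup.mk0 ⟨I, hImem⟩) with h1 | hcl | hcl | hcl | hcl | hcl
  · obtain ⟨z, hz⟩ := ((ClassGroup.mk0_eq_one_iff hImem).mp h1).principal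
    have hz' : I = span {z} := by rw [hz, submodule_span_eq]
    have hz0 : z ≠ 0 := by
      rintro rfl
      apply hI0
      rw [hz', Ideal.span_singleton_eq_bot]
    refine ⟨1, (e.symm : 𝓞 (CSField 32) →+* AdjoinRoot (csPoly 32)) z, one_ne_zero,
      (map_ne_zero_iff _ e.symm.injective).mpr hz0, Or.inl ?_⟩
    rw [Ideal.span_singleton_one, Ideal.top_mul, csIdeal_one_one, Ideal.mul_top, ← hIJ, hz',
      Ideal.map_span, Set.image_singleton]
  · obtain ⟨x, y, hx, hy, h⟩ := hcase _ _ _ hP5_4 hcl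
    exact ⟨x, y, hx, hy, Or.inr (Or.inl h)⟩
  · obtain ⟨x, y, hx, hy, h⟩ := hcase _ _ _ hP23_18 hcl
    exact ⟨x, y, hx, hy, Or.inr (Or.inr (Or.inl h))⟩
  · obtain ⟨x, y, hx, hy, h⟩ := hcase _ _ _ hP13_3 hcl
    exact ⟨x, y, hx, hy, Or.inr (Or.inr (Or.inr (Or.inl h)))⟩
  · obtain ⟨x, y, hx, hy, h⟩ := hcase _ _ _ hP13_4 hcl
    exact ⟨x, y, hx, hy, Or.inr (Or.inr (Or.inr (Or.inr (Or.inl h))))⟩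
  · obtain ⟨x, y, hx, hy, h⟩ := hcase _ _ _ hP13_12 hcl
    exact ⟨x, y, hx, hy, Or.inr (Or.inr (Or.inr (Or.inr (Or.inr (h)))))⟩

/-- `5 ∣ f₃₂(4)`: `(4, 5, 32) ∈ 𝒞𝒮`. [cite: KimYamada2023, §6.1 (proof of Thm. B)] -/
theorem rep0_dvd_eval_csPoly_thirtytwo : (5 : ℤ) ∣ (csPoly 32).eval 4 := by
  rw [eval_csPoly]; norm_num

/-- `23 ∣ f₃₂(18)`: `(18, 23, 32) ∈ 𝒞𝒮`. [cite: KimYamada2023, §6.1 (proof of Thm. B)] -/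
theorem rep1_dvd_eval_csPoly_thirtytwo : (23 : ℤ) ∣ (csPoly 32).eval 18 := by
  rw [eval_csPoly]; norm_num

/-- `13 ∣ f₃₂(3)`: `(3, 13, 32) ∈ 𝒞𝒮`. [cite: KimYamada2023, §6.1 (proof of Thm. B)] -/
theorem rep2_dvd_eval_csPoly_thirtytwo : (13 : ℤ) ∣ (csPoly 32).eval 3 := by
  rw [eval_csPoly]; norm_num

/-- `13 ∣ f₃₂(4)`: `(4, 13, 32) ∈ 𝒞𝒮`. [cite: KimYamada2023, §6.1 (proof of Thm. B)] -/
theorem rep3_dvd_eval_csPoly_thirtytwo : (13 : ℤ) ∣ (csPoly 32).eval 4 := by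
  rw [eval_csPoly]; norm_num

/-- `13 ∣ f₃₂(12)`: `(12, 13, 32) ∈ 𝒞𝒮`. [cite: KimYamada2023, §6.1 (proof of Thm. B)] -/
theorem rep4_dvd_eval_csPoly_thirtytwo : (13 : ℤ) ∣ (csPoly 32).eval 12 := by
  rw [eval_csPoly]; norm_num

/-- **Every Cappell–Shaneson matrix of trace `32` is similar to one of 6 standard matrices**
(Prop. 2.14). [cite: KimYamada2023, §6.1 (proof of Thm. B) and Prop. 2.14] -/
theorem isConj_standardCSMatrix_of_trace_eq_thirtytwo (A : SL(3, ℤ))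
    (hdet : ((A : Matrix (Fin 3) (Fin 3) ℤ) - 1).det = 1)
    (htr : Matrix.trace (A : Matrix (Fin 3) (Fin 3) ℤ) = 32) :
    IsConj A (standardCSMatrix 1 1 32 (one_dvd _)) ∨
      IsConj A (standardCSMatrix 4 5 32 rep0_dvd_eval_csPoly_thirtytwo) ∨
      IsConj A (standardCSMatrix 18 23 32 rep1_dvd_eval_csPoly_thirtytwo) ∨
      IsConj A (standardCSMatrix 3 13 32 rep2_dvd_eval_csPoly_thirtytwo) ∨
      IsConj A (standardCSMatrix 4 13 32 rep3_dvd_eval_csPoly_thirtytwo) ∨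
      IsConj A (standardCSMatrix 12 13 32 rep4_dvd_eval_csPoly_thirtytwo) := by
  have hcover : ∀ J : Ideal (AdjoinRoot (csPoly 32)), J ≠ ⊥ →
      ∃ (c d : ℤ) (_ : d ∣ (csPoly 32).eval c) (x y : AdjoinRoot (csPoly 32)),
        x ≠ 0 ∧ y ≠ 0 ∧ Ideal.span {x} * J = Ideal.span {y} * csIdeal c d 32 ∧
          ((c = 1 ∧ d = 1) ∨ (c = 4 ∧ d = 5) ∨ (c = 18 ∧ d = 23) ∨ (c = 3 ∧ d = 13) ∨ (c = 4 ∧ d = 13) ∨ (c = 12 ∧ d = 13)) := by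
    intro J hJ
    obtain ⟨x, y, hx, hy, hxy⟩ := ideal_class_adjoinRoot_thirtytwo J hJ
    rcases hxy with h0 | h1 | h2 | h3 | h4 | h5
    · exact ⟨1, 1, one_dvd _, x, y, hx, hy, h0, Or.inl ⟨rfl, rfl⟩⟩
    · exact ⟨4, 5, rep0_dvd_eval_csPoly_thirtytwo, x, y, hx, hy, h1, Or.inr (Or.inl ⟨rfl, rfl⟩)⟩
    · exact ⟨18, 23, rep1_dvd_eval_csPoly_thirtytwo, x, y, hx, hy, h2, Or.inr (Or.inr (Or.inl ⟨rfl, rfl⟩))⟩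
    · exact ⟨3, 13, rep2_dvd_eval_csPoly_thirtytwo, x, y, hx, hy, h3, Or.inr (Or.inr (Or.inr (Or.inl ⟨rfl, rfl⟩)))⟩
    · exact ⟨4, 13, rep3_dvd_eval_csPoly_thirtytwo, x, y, hx, hy, h4, Or.inr (Or.inr (Or.inr (Or.inr (Or.inl ⟨rfl, rfl⟩))))⟩
    · exact ⟨12, 13, rep4_dvd_eval_csPoly_thirtytwo, x, y, hx, hy, h5, Or.inr (Or.inr (Or.inr (Or.inr (Or.inr (⟨rfl, rfl⟩)))))⟩
  obtain ⟨c, d, h, hconj, hcd⟩ := exists_isConj_standardCSMatrix_of_cover _ hcover A hdet htr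
  rcases hcd with ⟨rfl, rfl⟩ | ⟨rfl, rfl⟩ | ⟨rfl, rfl⟩ | ⟨rfl, rfl⟩ | ⟨rfl, rfl⟩ | ⟨rfl, rfl⟩
  · exact Or.inl hconj
  · exact Or.inr (Or.inl hconj)
  · exact Or.inr (Or.inr (Or.inl hconj))
  · exact Or.inr (Or.inr (Or.inr (Or.inl hconj)))
  · exact Or.inr (Or.inr (Or.inr (Or.inr (Or.inl hconj))))
  · exact Or.inr (Or.inr (Or.inr (Or.inr (Or.inr (hconj)))))

/-- **Kim–Yamada 2023, Theorem B for the trace `32`, PROVED**: the non-trivial classes move by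
Gompf moves to the traces `2` (from `(4, 5, 32)`), `9` (from `(18, 23, 32)`), `6` (from `(3, 13, 32)`), `6` (from `(4, 13, 32)`), `6` (from `(12, 13, 32)`), where Gompf's conjecture holds. [cite: KimYamada2023, Thm. B, Lemma 6.1 and §6.1] -/
theorem gompfConjectureForTrace_thirtytwo : GompfConjectureForTrace 32 := by
  intro A hdet htr
  rcases isConj_standardCSMatrix_of_trace_eq_thirtytwo A hdet htr with h0 | h1 | h2 | h3 | h4 | h5
  · exact (GompfEquiv.of_isConj h0).trans (gompfEquiv_standardCSMatrix_one_one 30 (one_dvd _))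
  · exact (GompfEquiv.of_isConj h1).trans
      (gompfEquiv_standardCSMatrix_akbulutKirbyMatrix_of_modEq
        (gompfConjectureForTrace_of_mem_Icc_neg_seven_twelve (by norm_num)) rep0_dvd_eval_csPoly_thirtytwo
        (show (32 : ℤ) ≡ 2 [ZMOD 5] by decide))
  · exact (GompfEquiv.of_isConj h2).trans
      (gompfEquiv_standardCSMatrix_akbulutKirbyMatrix_of_modEq
        (gompfConjectureForTrace_of_mem_Icc_neg_seven_twelve (by norm_num)) rep1_dvd_eval_csPoly_thirtytwo
        (show (32 : ℤ) ≡ 9 [ZMOD 23] by decide))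
  · exact (GompfEquiv.of_isConj h3).trans
      (gompfEquiv_standardCSMatrix_akbulutKirbyMatrix_of_modEq
        (gompfConjectureForTrace_of_mem_Icc_neg_seven_twelve (by norm_num)) rep2_dvd_eval_csPoly_thirtytwo
        (show (32 : ℤ) ≡ 6 [ZMOD 13] by decide))
  · exact (GompfEquiv.of_isConj h4).trans
      (gompfEquiv_standardCSMatrix_akbulutKirbyMatrix_of_modEq
        (gompfConjectureForTrace_of_mem_Icc_neg_seven_twelve (by norm_num)) rep3_dvd_eval_csPoly_thirtytwo
        (show (32 : ℤ) ≡ 6 [ZMOD 13] by decide))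
  · exact (GompfEquiv.of_isConj h5).trans
      (gompfEquiv_standardCSMatrix_akbulutKirbyMatrix_of_modEq
        (gompfConjectureForTrace_of_mem_Icc_neg_seven_twelve (by norm_num)) rep4_dvd_eval_csPoly_thirtytwo
        (show (32 : ℤ) ≡ 6 [ZMOD 13] by decide))

/-- **Theorem B for the trace `-27`** (`= 5 - 32`), by Theorem A. [cite: KimYamada2023, Thm. A and Thm. B] -/
theorem gompfConjectureForTrace_neg_twentyseven : GompfConjectureForTrace (-27) := by
  have h := gompfConjectureForTrace_of_five_sub gompfConjectureForTrace_thirtytwo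
  norm_num at h
  exact h

end Matrices


end Literature.Topology.FourManifolds

end
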